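import Mathlib.Analysis.InnerProductSpace.PiL2
import Mathlib.Analysis.InnerProductSpace.Projection.FiniteDimensional
import Mathlib.Geometry.Euclidean.Angle.Unoriented.Basic
import Literature.Geometry.DiscreteGeometry.SphericalCodeContactGraph
import HarnessLib

/-!
# The spherical rhombus: opposite angles are equal and `cot(u₁/2) cot(u₂/2) = cos d`
# (Musin–Tarasov 2012, §3.2 case `m = 4`, Proposition 3.8) — proved

Topic `Literature/Geometry/DiscreteGeometry`; brick 5 of the Musin–Tarasov programme (named fact
`musinTarasov2012_tammes_thirteen`; see `SphericalCodeContactGraph.lean`,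
`SphericalCodeOptimal.lean`, `RankinOrthoplexBound.lean`, `SphericalCodeIrreducible.lean`).
A quadrilateral face of a contact graph is "a rhombus" (all sides `= d`), and §3.2 /
Proposition 3.8 record its geometry:
opposite angles equal, adjacent angles tied by `cot(u₁/2) cot(u₂/2) = cos d`, hence
`α(d) ≤ uᵢ ≤ 2α(d)`.  This file PROVES these for every equilateral spherical quadrilateral
`A₁A₂A₃A₄` on `S² ⊂ ℝ³` (no faces, planarity or convexity needed beyond `A₁ ≠ A₃`, `A₂ ≠ A₄`);
no named facts.

## Source (verbatim, arXiv:1002.1439v3, §3.2)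

"2. `m = 4`: quadrilateral. In this case, `F = A₁A₂A₃A₄` is a rhombus. Then we have `u₁ = u₃` and
`u₂ = u₄`. Using the spherical Pythagorean theorem, one can show that
`cot(u₁/2) cot(u₂/2) = cos d`. Then `u₂ = ρ(u₁, d) := 2 cot⁻¹(tan(u₁/2) cos d)`. Since
`u₂ ≥ α(d)`, we have `u₁ = ρ(u₂, d) ≤ ρ(α(d), d) = 2α(d)`.  **Proposition 3.8.** Let `F` be a
quadrilateral of `G₁₃` with angles `u₁, u₂, u₃, u₄`. Then `u₃ = u₁`, `u₄ = u₂`,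
`u₂ = ρ(u₁, d₁₃)`, `u₁ = ρ(u₂, d₁₃)`, and `α₁₃ ≤ uᵢ ≤ 2α₁₃` for all `i = 1, 2, 3, 4`."

## What is proved, and in which form

Inner products encode the sphere: sides `⟪Aᵢ, Aᵢ₊₁⟫ = κ = cos d`, diagonals `p = ⟪A₂, A₄⟫`,
`q = ⟪A₁, A₃⟫`; the angle of the quadrilateral at a vertex is `faceAngle v u w`, the angle between
the tangential components (`tangentProj`) of the two neighbours, with
`cos ∠ = (⟪u, w⟫ − κ²)/(1 − κ²)` (`cos_faceAngle`).
* `rhombus_diagonal_relation` — **`(1 + q)(1 + p) = 4κ²`** (the heart of the matter; proof by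
  dimension: `A₁ − A₃ ⊥ A₂ − A₄`, both `⊥ A₁ + A₃, A₂ + A₄`, so in `ℝ³` the latter two are parallel
  and Cauchy–Schwarz is an equality: `(4κ)² = (2 + 2q)(2 + 2p)`).  In the paper's picture: the
  diagonals are perpendicular and bisect the angles, and Napier's rule `cos c = cot A cot B` in
  the right triangle (centre, `A₁`, `A₂`) is the printed "spherical Pythagorean theorem" step.
* `rhombus_faceAngle_opposite` — **`u₃ = u₁`** (and symmetrically `u₄ = u₂`).
* `rhombus_halfAngle_relation` — **`(1 + cos u₁)(1 + cos u₂) = κ²(1 − cos u₁)(1 − cos u₂)`**, i.e.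
  `cot²(u₁/2) cot²(u₂/2) = cos² d` — the printed relation squared (all quantities positive for
  `d < 90°`, `0 < uᵢ < π`), which is the form the LP relaxations of §4 (iv) use through
  `u₁ + u₂`.
* `rhombus_cos_faceAngle_bounds` — **`α ≤ u₁ ≤ 2α`** in cosine form, `cos 2α ≤ cos u₁ ≤ cos α`
  with `cos α = κ/(1 + κ)`, assuming `0 < κ < 1` and that the diagonal vertices are at distance
  `≥ d` (`p, q ≤ κ`, automatic for non-adjacent vertices of a `ψ`-code).

## References

* O. R. Musin, A. S. Tarasov, Discrete Comput. Geom. 48 (2012) 128–141 = arXiv:1002.1439, §3.2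
  (case `m = 4`) and Proposition 3.8. [`MusinTarasov2012`]
-/

noncomputable section

namespace Literature.Geometry.DiscreteGeometry

open Real RealInnerProductSpace InnerProductGeometry Module

/-! ### Part A. The diagonal relation of an equilateral spherical quadrilateral in `ℝ³` -/

/-- **The diagonals of a spherical rhombus.**  Let `A₁, A₂, A₃, A₄ ∈ S² ⊂ ℝ³` be unit vectors
with the four "sides" `⟪A₁, A₂⟫ = ⟪A₂, A₃⟫ = ⟪A₃, A₄⟫ = ⟪A₄, A₁⟫ = κ` (an equilateral spherical
quadrilateral of side `d`, `κ = cos d`) and `A₁ ≠ A₃`, `A₂ ≠ A₄`.  Then the diagonals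
`q = ⟪A₁, A₃⟫`, `p = ⟪A₂, A₄⟫` satisfy `(1 + q)(1 + p) = 4κ²`.  Proof: `d₁ = A₁ − A₃` and
`d₂ = A₂ − A₄` are nonzero and orthogonal, and `s = A₁ + A₃`, `t = A₂ + A₄` are orthogonal to
both, hence (dimension `3`) parallel; Cauchy–Schwarz with equality gives
`⟪s, t⟫² = ‖s‖²‖t‖²`, i.e. `(4κ)² = (2 + 2q)(2 + 2p)`.  (In Musin–Tarasov this is the symmetry of
the rhombus — its diagonals are perpendicular great-circle arcs meeting at the centre — combined
with Napier's rule `cos c = cot A cot B` for the right triangle centre–`A₁`–`A₂`; see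
`rhombus_halfAngle_relation` below.) [cite: MusinTarasov2012, Proposition 3.8 (proof: "using the
spherical Pythagorean theorem")] -/
theorem rhombus_diagonal_relation {A₁ A₂ A₃ A₄ : EuclideanSpace ℝ (Fin 3)} (h₁ : ‖A₁‖ = 1)
    (h₂ : ‖A₂‖ = 1) (h₃ : ‖A₃‖ = 1) (h₄ : ‖A₄‖ = 1) {κ : ℝ} (h12 : ⟪A₁, A₂⟫ = κ)
    (h23 : ⟪A₂, A₃⟫ = κ) (h34 : ⟪A₃, A₄⟫ = κ) (h41 : ⟪A₄, A₁⟫ = κ) (h13 : A₁ ≠ A₃)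
    (h24 : A₂ ≠ A₄) : (1 + ⟪A₁, A₃⟫) * (1 + ⟪A₂, A₄⟫) = 4 * κ ^ 2 := by
  have h11 : ⟪A₁, A₁⟫ = 1 := by rw [real_inner_self_eq_norm_sq, h₁]; norm_num
  have h22 : ⟪A₂, A₂⟫ = 1 := by rw [real_inner_self_eq_norm_sq, h₂]; norm_num
  have h33 : ⟪A₃, A₃⟫ = 1 := by rw [real_inner_self_eq_norm_sq, h₃]; norm_num
  have h44 : ⟪A₄, A₄⟫ = 1 := by rw [real_inner_self_eq_norm_sq, h₄]; norm_num
  have h21 : ⟪A₂, A₁⟫ = κ := by rw [real_inner_comm]; exact h12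
  have h32 : ⟪A₃, A₂⟫ = κ := by rw [real_inner_comm]; exact h23
  have h43 : ⟪A₄, A₃⟫ = κ := by rw [real_inner_comm]; exact h34
  have h14 : ⟪A₁, A₄⟫ = κ := by rw [real_inner_comm]; exact h41
  have h31 : ⟪A₃, A₁⟫ = ⟪A₁, A₃⟫ := real_inner_comm _ _
  have h42 : ⟪A₄, A₂⟫ = ⟪A₂, A₄⟫ := real_inner_comm _ _
  set s := A₁ + A₃ with hs
  set t := A₂ + A₄ with ht
  set d₁ := A₁ - A₃ with hd₁
  set d₂ := A₂ - A₄ with hd₂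
  have hd₁0 : d₁ ≠ 0 := sub_ne_zero.2 h13
  have hd₂0 : d₂ ≠ 0 := sub_ne_zero.2 h24
  -- orthogonality relations
  have o12 : ⟪d₁, d₂⟫ = 0 := by
    simp only [hd₁, hd₂, inner_sub_left, inner_sub_right, h12, h14, h32, h34]; ring
  have os1 : ⟪d₁, s⟫ = 0 := by
    simp only [hd₁, hs, inner_sub_left, inner_add_right, h11, h33, h31]; ring
  have ot1 : ⟪d₁, t⟫ = 0 := by
    simp only [hd₁, ht, inner_sub_left, inner_add_right, h12, h14, h32, h34]; ring
  have os2 : ⟪d₂, s⟫ = 0 := by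
    simp only [hd₂, hs, inner_sub_left, inner_add_right, h21, h23, h41, h43]; ring
  have ot2 : ⟪d₂, t⟫ = 0 := by
    simp only [hd₂, ht, inner_sub_left, inner_add_right, h22, h44, h42]; ring
  -- the values we need
  have hss : ⟪s, s⟫ = 2 + 2 * ⟪A₁, A₃⟫ := by
    simp only [hs, inner_add_left, inner_add_right, h11, h33, h31]; ring
  have htt : ⟪t, t⟫ = 2 + 2 * ⟪A₂, A₄⟫ := by
    simp only [ht, inner_add_left, inner_add_right, h22, h44, h42]; ring
  have hst : ⟪s, t⟫ = 4 * κ := by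
    simp only [hs, ht, inner_add_left, inner_add_right, h12, h14, h32, h34]; ring
  -- `K = span {d₁, d₂}` has dimension `2`, so `Kᗮ` has dimension `1` and contains `s, t`
  set K : Submodule ℝ (EuclideanSpace ℝ (Fin 3)) := Submodule.span ℝ (Set.range ![d₁, d₂])
    with hKdef
  have hli : LinearIndependent ℝ ![d₁, d₂] := by
    refine linearIndependent_of_ne_zero_of_inner_eq_zero (fun i => ?_) (fun i j hij => ?_)
    · fin_cases i
      · exact hd₁0
      · exact hd₂0
    · fin_cases i <;> fin_cases j
      · exact absurd rfl hij
      · exact o12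
      · simpa [real_inner_comm] using o12
      · exact absurd rfl hij
  have hK2 : finrank ℝ K = 2 := by
    rw [hKdef, finrank_span_eq_card hli, Fintype.card_fin]
  have hKo : finrank ℝ Kᗮ = 1 := by
    have := Submodule.finrank_add_finrank_orthogonal K
    rw [hK2, finrank_euclideanSpace_fin] at this
    omega
  have hmemo : ∀ z, ⟪d₁, z⟫ = 0 → ⟪d₂, z⟫ = 0 → z ∈ Kᗮ := by
    intro z hz1 hz2
    rw [Submodule.mem_orthogonal]
    intro u hu
    rw [hKdef] at hu
    have hrange : Set.range ![d₁, d₂] = {d₁, d₂} := by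
      ext w
      simp only [Set.mem_range, Set.mem_insert_iff, Set.mem_singleton_iff]
      constructor
      · rintro ⟨i, rfl⟩
        fin_cases i
        · exact Or.inl rfl
        · exact Or.inr rfl
      · rintro (rfl | rfl)
        · exact ⟨0, rfl⟩
        · exact ⟨1, rfl⟩
    rw [hrange, Submodule.mem_span_pair] at hu
    obtain ⟨a, b, rfl⟩ := hu
    rw [inner_add_left, real_inner_smul_left, real_inner_smul_left, hz1, hz2]; ring
  have hsK : s ∈ Kᗮ := hmemo s os1 os2
  have htK : t ∈ Kᗮ := hmemo t ot1 ot2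
  -- Cauchy–Schwarz with equality in the line `Kᗮ`
  have hcs : ⟪s, t⟫ ^ 2 = ⟪s, s⟫ * ⟪t, t⟫ := by
    by_cases hs0 : s = 0
    · rw [hs0, inner_zero_left, inner_zero_left]; ring
    · have hs0' : (⟨s, hsK⟩ : Kᗮ) ≠ 0 := fun e => hs0 (by simpa using congrArg Subtype.val e)
      obtain ⟨c, hc⟩ := (finrank_eq_one_iff_of_nonzero' (⟨s, hsK⟩ : Kᗮ) hs0').1 hKo ⟨t, htK⟩
      have hct : c • s = t := by simpa using congrArg Subtype.val hc
      rw [← hct, real_inner_smul_right, real_inner_smul_left, real_inner_smul_right]; ring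
  rw [hst, hss, htt] at hcs
  nlinarith [hcs]

/-! ### Part B. Face angles of the rhombus (Proposition 3.8) -/

/-- **The angle of a spherical polygon at a vertex**: the angle at `v` between the geodesics to
`u` and to `w`, i.e. between the tangential components `tangentProj v u`, `tangentProj v w`
(`SphericalCodeContactGraph.lean`). [cite: MusinTarasov2012, §3.2 (the angles uᵢ of the faces)] -/
def faceAngle (v u w : EuclideanSpace ℝ (Fin 3)) : ℝ := angle (tangentProj v u) (tangentProj v w)

/-- `cos` of the angle at `v` between two points at level `κ ∈ (−1, 1)`:
`cos ∠ = (⟪u, w⟫ − κ²)/(1 − κ²)`. [cite: MusinTarasov2012, §3.2] -/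
theorem cos_faceAngle {v u w : EuclideanSpace ℝ (Fin 3)} (hv : ‖v‖ = 1) (hu : ‖u‖ = 1)
    (hw : ‖w‖ = 1) {κ : ℝ} (hκ : κ ^ 2 < 1) (hvu : ⟪v, u⟫ = κ) (hvw : ⟪v, w⟫ = κ) :
    Real.cos (faceAngle v u w) = (⟪u, w⟫ - κ ^ 2) / (1 - κ ^ 2) := by
  unfold faceAngle
  rw [cos_angle, inner_tangentProj v u w hv, hvu, hvw]
  have hn : ∀ z, ‖z‖ = 1 → ⟪v, z⟫ = κ → ‖tangentProj v z‖ = Real.sqrt (1 - κ ^ 2) := by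
    intro z hz hvz
    have h2 := norm_sq_tangentProj hv hz
    rw [hvz] at h2
    rw [← h2, Real.sqrt_sq (norm_nonneg _)]
  rw [hn u hu hvu, hn w hw hvw, Real.mul_self_sqrt (by linarith)]
  ring

/-- **Proposition 3.8, opposite angles: `u₃ = u₁` (and `u₄ = u₂`)** — both have cosine
`(⟪A₂, A₄⟫ − κ²)/(1 − κ²)`. [cite: MusinTarasov2012, Proposition 3.8] -/
theorem rhombus_faceAngle_opposite {A₁ A₂ A₃ A₄ : EuclideanSpace ℝ (Fin 3)} (h₁ : ‖A₁‖ = 1)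
    (h₂ : ‖A₂‖ = 1) (h₃ : ‖A₃‖ = 1) (h₄ : ‖A₄‖ = 1) {κ : ℝ} (hκ : κ ^ 2 < 1)
    (h12 : ⟪A₁, A₂⟫ = κ) (h23 : ⟪A₂, A₃⟫ = κ) (h34 : ⟪A₃, A₄⟫ = κ) (h41 : ⟪A₄, A₁⟫ = κ) :
    faceAngle A₃ A₂ A₄ = faceAngle A₁ A₂ A₄ := by
  have h14 : ⟪A₁, A₄⟫ = κ := by rw [real_inner_comm]; exact h41
  have h32 : ⟪A₃, A₂⟫ = κ := by rw [real_inner_comm]; exact h23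
  apply injOn_cos (Set.mem_Icc.2 ⟨angle_nonneg _ _, angle_le_pi _ _⟩)
    (Set.mem_Icc.2 ⟨angle_nonneg _ _, angle_le_pi _ _⟩)
  change Real.cos (faceAngle A₃ A₂ A₄) = Real.cos (faceAngle A₁ A₂ A₄)
  rw [cos_faceAngle h₃ h₂ h₄ hκ h32 h34, cos_faceAngle h₁ h₂ h₄ hκ h12 h14]

/-- **Proposition 3.8, the relation between adjacent angles**, in the form
`(1 + cos u₁)(1 + cos u₂) = κ² (1 − cos u₁)(1 − cos u₂)` — i.e. `cot²(u₁/2) cot²(u₂/2) = cos² d`,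
Musin–Tarasov's `cot(u₁/2) cot(u₂/2) = cos d` squared (for `d < 90°` and `0 < uᵢ < π` all
factors are positive, so nothing is lost) — where `u₁ = ∠A₁` (between `A₂, A₄`) and
`u₂ = ∠A₂` (between `A₁, A₃`) are adjacent angles of the spherical rhombus of side `d`,
`κ = cos d ∈ (−1, 1)`, `A₁ ≠ A₃`, `A₂ ≠ A₄`.  From `rhombus_diagonal_relation`:
`1 ± cos u₁ = (1 + p − 2κ², 1 − p)/(1 − κ²)` with `p = ⟪A₂, A₄⟫`, similarly for `u₂` with
`q = ⟪A₁, A₃⟫`, and `(1+p)(1+q) = 4κ²`. [cite: MusinTarasov2012, Proposition 3.8] -/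
theorem rhombus_halfAngle_relation {A₁ A₂ A₃ A₄ : EuclideanSpace ℝ (Fin 3)} (h₁ : ‖A₁‖ = 1)
    (h₂ : ‖A₂‖ = 1) (h₃ : ‖A₃‖ = 1) (h₄ : ‖A₄‖ = 1) {κ : ℝ} (hκ : κ ^ 2 < 1)
    (h12 : ⟪A₁, A₂⟫ = κ) (h23 : ⟪A₂, A₃⟫ = κ) (h34 : ⟪A₃, A₄⟫ = κ) (h41 : ⟪A₄, A₁⟫ = κ)
    (h13 : A₁ ≠ A₃) (h24 : A₂ ≠ A₄) :
    (1 + Real.cos (faceAngle A₁ A₂ A₄)) * (1 + Real.cos (faceAngle A₂ A₁ A₃)) =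
      κ ^ 2 * ((1 - Real.cos (faceAngle A₁ A₂ A₄)) * (1 - Real.cos (faceAngle A₂ A₁ A₃))) := by
  have h14 : ⟪A₁, A₄⟫ = κ := by rw [real_inner_comm]; exact h41
  have h21 : ⟪A₂, A₁⟫ = κ := by rw [real_inner_comm]; exact h12
  have hrel := rhombus_diagonal_relation h₁ h₂ h₃ h₄ h12 h23 h34 h41 h13 h24
  rw [cos_faceAngle h₁ h₂ h₄ hκ h12 h14, cos_faceAngle h₂ h₁ h₃ hκ h21 h23]
  have hD : (1 - κ ^ 2) ≠ 0 := by linarith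
  set p := ⟪A₂, A₄⟫ with hp
  set q := ⟪A₁, A₃⟫ with hq
  have e1 : 1 + (p - κ ^ 2) / (1 - κ ^ 2) = (1 + p - 2 * κ ^ 2) / (1 - κ ^ 2) := by
    field_simp; ring
  have e2 : 1 - (p - κ ^ 2) / (1 - κ ^ 2) = (1 - p) / (1 - κ ^ 2) := by
    field_simp; ring
  have e3 : 1 + (q - κ ^ 2) / (1 - κ ^ 2) = (1 + q - 2 * κ ^ 2) / (1 - κ ^ 2) := by
    field_simp; ring
  have e4 : 1 - (q - κ ^ 2) / (1 - κ ^ 2) = (1 - q) / (1 - κ ^ 2) := by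
    field_simp; ring
  rw [e1, e2, e3, e4, div_mul_div_comm, div_mul_div_comm, ← mul_div_assoc,
    div_left_inj' (mul_ne_zero hD hD)]
  linear_combination (1 - κ ^ 2) * hrel

/-- **Proposition 3.8, the bounds `α₁₃ ≤ uᵢ ≤ 2α₁₃`**, in cosine form.  If moreover the two
diagonals are at least a side (`⟪A₁, A₃⟫ ≤ κ`, `⟪A₂, A₄⟫ ≤ κ` — in a contact graph the
diagonal vertices are non-adjacent points of the code) and `0 < κ` (`d < 90°`), then
`cos(2α) ≤ cos uᵢ ≤ cos α` with `cos α = κ/(1+κ)`, `cos 2α = 2κ²/(1+κ)² − 1`: each angle of the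
rhombus lies in `[α(d), 2α(d)]` ("`u₁ = ρ(u₂, d) ≤ ρ(α(d), d) = 2α(d)`").
[cite: MusinTarasov2012, Proposition 3.8] -/
theorem rhombus_cos_faceAngle_bounds {A₁ A₂ A₃ A₄ : EuclideanSpace ℝ (Fin 3)} (h₁ : ‖A₁‖ = 1)
    (h₂ : ‖A₂‖ = 1) (h₃ : ‖A₃‖ = 1) (h₄ : ‖A₄‖ = 1) {κ : ℝ} (hκ0 : 0 < κ) (hκ1 : κ < 1)
    (h12 : ⟪A₁, A₂⟫ = κ) (h23 : ⟪A₂, A₃⟫ = κ) (h34 : ⟪A₃, A₄⟫ = κ) (h41 : ⟪A₄, A₁⟫ = κ)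
    (h13 : ⟪A₁, A₃⟫ ≤ κ) (h24 : ⟪A₂, A₄⟫ ≤ κ) :
    2 * κ ^ 2 / (1 + κ) ^ 2 - 1 ≤ Real.cos (faceAngle A₁ A₂ A₄) ∧
      Real.cos (faceAngle A₁ A₂ A₄) ≤ κ / (1 + κ) := by
  have hκ : κ ^ 2 < 1 := by nlinarith
  have h14 : ⟪A₁, A₄⟫ = κ := by rw [real_inner_comm]; exact h41
  have hne13 : A₁ ≠ A₃ := fun e => by
    have : ⟪A₁, A₃⟫ = 1 := by rw [← e, real_inner_self_eq_norm_sq, h₁]; norm_num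
    linarith
  have hne24 : A₂ ≠ A₄ := fun e => by
    have : ⟪A₂, A₄⟫ = 1 := by rw [← e, real_inner_self_eq_norm_sq, h₂]; norm_num
    linarith
  have hrel := rhombus_diagonal_relation h₁ h₂ h₃ h₄ h12 h23 h34 h41 hne13 hne24
  rw [cos_faceAngle h₁ h₂ h₄ hκ h12 h14]
  have hD : 0 < 1 - κ ^ 2 := by linarith
  have hq1 : -1 ≤ ⟪A₁, A₃⟫ := by
    have := abs_real_inner_le_norm A₁ A₃
    rw [h₁, h₃, mul_one] at this
    exact neg_le_of_abs_le this
  constructor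
  · -- lower bound from `(1 + p) ≥ 4κ²/(1 + q) ≥ 4κ²/(1 + κ)`
    rw [div_sub_one (by positivity), div_le_div_iff₀ (by positivity) hD]
    -- `(1+p)(1+q) = 4κ²` and `1 + q ≤ 1 + κ` give `4κ² ≤ (1+p)(1+κ)`
    have h1 : 4 * κ ^ 2 ≤ (1 + ⟪A₂, A₄⟫) * (1 + κ) := by
      have hp1 : 0 ≤ 1 + ⟪A₂, A₄⟫ := by
        have := abs_real_inner_le_norm A₂ A₄
        rw [h₂, h₄, mul_one] at this
        linarith [neg_le_of_abs_le this]
      nlinarith [mul_le_mul_of_nonneg_left (show 1 + ⟪A₁, A₃⟫ ≤ 1 + κ by linarith) hp1]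
    nlinarith [h1]
  · rw [div_le_div_iff₀ hD (by linarith)]
    nlinarith

end Literature.Geometry.DiscreteGeometry

end
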